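/-
Copyright (c) 2026 the pub-hodgecm-mathlib formalisation cell (harness21).  Prover seat hodgecm-mathlib-LH4-p07 (g8), req620 Track A «(D-RAM) FOUR-FRAME» squad
(STAGE-1b pre-scoping, heir LEAD F0P3a-plan (g20∕g21) T19-24 clause; dealer LH4-plan (g12∕g13) WORD #36 «p07 (g8): row-(2) lead»), 2026-09-04.
-/
import Summits.HodgeConjecture.HodgeConjecture.Theorems.F0P3cDyRamBlockCensusOrderFormToken   -- ★ p858981 (this seat): `forall_inv_smul_mulVec_mem_iff_of_line`, (C₂^X); brings ★ p858844 (W4₂), ★ (C1) p857559, ★ W-side census, ★ DEFS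
import HarnessLib

/-!
# Crux `H413`, line LH4 «(D-RAM) FOUR-FRAME» — STAGE-1b, row (2): organ (C1-P^{X,Y}) part 2a «THE AXIS WITH TWO GENERIC BLOCK TOKENS, IN M-LETTERS»
# `#{B ∣ SD_W, γ₂B = B, c⁻¹X_W·B ⊆ B, c′⁻¹Y_W·B ⊆ B} = Σ_{j ≤ J} [lam, (jE c)⁻¹ξ, (jE c′)⁻¹η ∈ 𝒪_j]·#levelSet(j, 0)`

Cell `hodgecm-mathlib` (D-0151), FLOOR 0, crux item H413 = `stmt-HodgeConjecture-24833`, route of record `HCCMUnconditional`; squad F0∕P3c∕LH4; lane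
`--supports stmt-HodgeConjecture-24833 --as helper` (count-neutral; pays NO tier-0 row; the STAGE-1b rows `stub_rows_transvPlus ∕ transvMinus ∕ regular` stay OPEN).
THEOREMS ONLY (no `def`, no instance, no notation, no `sorry`).  Consumer: the STAGE-1b directive (heir LEAD F0P3a-plan, dealer LH4-plan), ROW (2) = TYPE-(2) POPULATION.

THE OBJECT.  The third residual unlabelled piece of ★ p858649 is the JOINT profile set `K_{a,b} = {u ∈ K ∣ X ∈ ϖ^a M₃(𝒪), X² ∈ ϖ^b M₃(𝒪)}` (`X = wMatrix u − 1`); its `G`-side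
census at `Γ` counts self-dual lattices with TWO tokens, `(Γ − 1)·M ⊆ ϖ^a·M ∧ (Γ − 1)²·M ⊆ ϖ^b·M` (★ p859113, this seat: the O-GLUE count cut by two generic block-at-1 tokens
`X·M ⊆ c·M ∧ Y·M ⊆ c′·M`).  This file is the AXIS TERM of that count in the letters of the torus `T_γ ⊂ M = E(γ₂)` with TWO LINE MULTIPLIERS `ξ, η` (`φ(X_W y) = ξ·φ y`,
`φ(Y_W y) = η·φ y`) — the two-token twin of ★ p858844 (`…OrderFormLevelAxis`):
* §1 (W4₃) the W-side order census with THREE multipliers (`lam`, `lam′`, `lam″`): ★ W4₂'s set identity ∩ the `lam″`-clause (★ W3 `forall_mul_mem_iff_isOrd`), and ★ W4's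
  disjoint truncated count `Σ_{j ≤ J} (if lam, lam′, lam″ ∈ 𝒪_{ϖE^j} then #levelSet(j, 0) else 0)`;
* §2 (C₂^{X,Y}) the count transport (★ (C)'s bijection `B ↦ φ(B)`, ★ `forall_inv_smul_mulVec_mem_iff_of_line` twice) and the axis in M-letters.
The cut cone layers and the HEAD (cells `levelSetDep(j,b;μ) ∩ levelSetDep(j,b;μ_X) ∩ levelSetDep(j,b;μ_Y)`) are part 2b (`…OrderFormTwoTokens`).
HONEST LABEL.  Count-neutral lattice bookkeeping over ★ organs; nothing printed is asserted; no census law is stated; `HC_CM` is proved only modulo the 7 printed citations (2 remaining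
named inputs: hLiu418 = `stmt-HodgeConjecture-24832`, h413 = `stmt-HodgeConjecture-24833`) until rung 0 closes.

## References
* [Kottwitz1986BaseChangeUnits] R. E. Kottwitz, *Base change for unit elements of Hecke algebras*, Compositio Math. 60 (1986): §1 pp. 240–241.
* [Jacobowitz1962] R. Jacobowitz, *Hermitian forms over local fields*, Amer. J. Math. 84 (1962): §4, §7.
* [Flicker1998UnitaryFL] Y. Z. Flicker, *Elementary proof of the fundamental lemma for a unitary group*, Canad. J. Math. 50 (1998): p. 84 REMARK.
-/

set_option autoImplicit false

noncomputable section

open scoped Valued WithZero Matrix MatrixGroups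
open WithZero
open scoped Classical
open Literature.NumberTheory.Automorphic Literature.NumberTheory.Automorphic.HermitianLattice Literature.NumberTheory.Automorphic.UnitaryLatticeTree
open Literature.NumberTheory.Rogawski1990
open Literature.NumberTheory.Automorphic.EllipticPlaneAsFieldLine
open Literature.NumberTheory.LocalFields.QuadraticOrder
open Summit.HodgeConjecture.HodgeConjecture.Cruxes.H413.F0P3cDyRamToricCensusDefs
open Summit.HodgeConjecture.HodgeConjecture.Cruxes.H413.F0P3cDyRamWSideOrderCensus
open Summit.HodgeConjecture.HodgeConjecture.Cruxes.H413.F0P3cDyRamConeLevelTransport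
open Summit.HodgeConjecture.HodgeConjecture.Cruxes.H413.F0P3cDyRamBlockGlueCount
open Summit.HodgeConjecture.HodgeConjecture.Cruxes.H413.F0P3cDyRamBlockGluePlane
open Summit.HodgeConjecture.HodgeConjecture.Cruxes.H413.F0P3cDyRamBlockGlueLevelCount
open Summit.HodgeConjecture.HodgeConjecture.Cruxes.H413.F0P3cDyRamBlockGlueTokenCount
open Summit.HodgeConjecture.HodgeConjecture.Cruxes.H413.F0P3cDyRamBlockCensusOrderForm
open Summit.HodgeConjecture.HodgeConjecture.Cruxes.H413.F0P3cDyRamBlockCensusOrderFormLevelAxis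
open Summit.HodgeConjecture.HodgeConjecture.Cruxes.H413.F0P3cDyRamBlockCensusOrderFormLevel
open Summit.HodgeConjecture.HodgeConjecture.Cruxes.H413.F0P3cDyRamBlockCensusOrderFormToken

namespace Summit.HodgeConjecture.HodgeConjecture.Cruxes.H413.F0P3cDyRamBlockCensusOrderFormTwoTokensAxis

/-! ## §1 (W4₃) The W-side order census with three multipliers -/

section WSide

variable {K : Type*} [Field K] [Valued K ℤᵐ⁰] {ρ Θ : K →+* K} {α : K}

/-- **(W4₃a) THE SET IDENTITY WITH THREE MULTIPLIERS**: the order lattices stable under `lam`, `lam′` AND `lam″` that are hermitian-self-dual are the members of the level-`0`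
sets of conductor `j` with `lam, lam′, lam″ ∈ 𝒪_{ϖE^j}` (★ W4₂a ∩ the `lam″`-clause, read by ★ W3). [cite: Kottwitz1986BaseChangeUnits, §1 pp. 240–241] [cite: Jacobowitz1962, §7] -/
theorem setOf_orderLatt_selfDual_stable₃_eq_iUnion (hρρ : ∀ x, ρ (ρ x) = x) (hvρ : ∀ x, Valued.v (ρ x) = Valued.v x) (hα : ρ α ≠ α) (hα1 : Valued.v α ≤ 1)
    (hint : ∀ z : K, Valued.v z ≤ 1 → Valued.v ((z - ρ z) / (α - ρ α)) ≤ 1)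
    (hΘΘ : ∀ x, Θ (Θ x) = x) (hΘρ : ∀ x, Θ (ρ x) = ρ (Θ x)) (hvΘ : ∀ x, Valued.v (Θ x) = Valued.v x)
    {ϖE : K} (hρϖ : ρ ϖE = ϖE) (hϖ0 : ϖE ≠ 0) (hϖ1 : Valued.v ϖE < 1)
    (hEval : ∀ c : K, ρ c = c → c ≠ 0 → Valued.v c ≤ 1 → ∃ n : ℕ, Valued.v c = Valued.v ϖE ^ n)
    {h : K} (hh : h ≠ 0) (lam lam' lam'' : K) :
    {Λ : AddSubgroup K | (∃ z c : K, z ≠ 0 ∧ ρ c = c ∧ c ≠ 0 ∧ Valued.v c ≤ 1 ∧ ∀ x, x ∈ Λ ↔ ∃ y, IsOrd ρ α c y ∧ x = z * y) ∧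
        (∀ x ∈ Λ, lam * x ∈ Λ) ∧ (∀ x ∈ Λ, lam' * x ∈ Λ) ∧ (∀ x ∈ Λ, lam'' * x ∈ Λ) ∧
        (∀ m, (∀ a ∈ Λ, Valued.v (h * Θ a * m + ρ (h * Θ a * m)) ≤ 1) ↔ m ∈ Λ)} =
      ⋃ j : ℕ, {Λ | Λ ∈ levelSet ρ Θ α ϖE h j 0 ∧ (IsOrd ρ α (ϖE ^ j) lam ∧ IsOrd ρ α (ϖE ^ j) lam' ∧ IsOrd ρ α (ϖE ^ j) lam'')} := by
  have hW4 := setOf_orderLatt_selfDual_stable₂_eq_iUnion hρρ hvρ hα hα1 hint hΘΘ hΘρ hvΘ hρϖ hϖ0 hϖ1 hEval hh lam lam'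
  ext Λ
  have hΛ := Set.ext_iff.1 hW4 Λ
  simp only [Set.mem_setOf_eq, Set.mem_iUnion] at hΛ ⊢
  constructor
  · rintro ⟨hord, hstab, hstab', hstab'', hself⟩
    obtain ⟨j, hlev, hlam, hlam'⟩ := hΛ.1 ⟨hord, hstab, hstab', hself⟩
    have hlev' := hlev
    obtain ⟨x₀, hx₀, hΛj, -, -, -⟩ := hlev'
    exact ⟨j, hlev, hlam, hlam', (forall_mul_mem_iff_isOrd hvρ hx₀ hΛj lam'').1 hstab''⟩
  · rintro ⟨j, hlev, hlam, hlam', hlam''⟩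
    obtain ⟨hord, hstab, hstab', hself⟩ := hΛ.2 ⟨j, hlev, hlam, hlam'⟩
    have hlev' := hlev
    obtain ⟨x₀, hx₀, hΛj, -, -, -⟩ := hlev'
    exact ⟨hord, hstab, hstab', (forall_mul_mem_iff_isOrd hvρ hx₀ hΛj lam'').2 hlam'', hself⟩

/-- **(W4₃) THE W-SIDE ORDER CENSUS WITH THREE MULTIPLIERS.**  If the level-`0` sets are finite and `lam ∉ 𝒪_{ϖE^{J+1}}`, then
`#{Λ ∣ Λ = z·𝒪_c ∧ lam·Λ ⊆ Λ ∧ lam′·Λ ⊆ Λ ∧ lam″·Λ ⊆ Λ ∧ Λ = Λ^♯} = Σ_{j ≤ J} (if lam, lam′, lam″ ∈ 𝒪_{ϖE^j} then #levelSet(j, 0) else 0)` — ★ W4's disjoint truncated count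
with the two extra multipliers in the indicator; the axis term of the joint profile census. [cite: Kottwitz1986BaseChangeUnits, §1 pp. 240–241] [cite: Flicker1998UnitaryFL, p. 84 REMARK] [cite: Jacobowitz1962, §7] -/
theorem ncard_orderLatt_selfDual_stable₃_eq_sum (hρρ : ∀ x, ρ (ρ x) = x) (hvρ : ∀ x, Valued.v (ρ x) = Valued.v x) (hα : ρ α ≠ α) (hα1 : Valued.v α ≤ 1)
    (hint : ∀ z : K, Valued.v z ≤ 1 → Valued.v ((z - ρ z) / (α - ρ α)) ≤ 1)
    (hΘΘ : ∀ x, Θ (Θ x) = x) (hΘρ : ∀ x, Θ (ρ x) = ρ (Θ x)) (hvΘ : ∀ x, Valued.v (Θ x) = Valued.v x)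
    {ϖE : K} (hρϖ : ρ ϖE = ϖE) (hϖ0 : ϖE ≠ 0) (hϖ1 : Valued.v ϖE < 1)
    (hEval : ∀ c : K, ρ c = c → c ≠ 0 → Valued.v c ≤ 1 → ∃ n : ℕ, Valued.v c = Valued.v ϖE ^ n)
    {h : K} (hh : h ≠ 0) (lam lam' lam'' : K) {J : ℕ} (hJ : ¬ IsOrd ρ α (ϖE ^ (J + 1)) lam) (hfin : ∀ j, (levelSet ρ Θ α ϖE h j 0).Finite) :
    {Λ : AddSubgroup K | (∃ z c : K, z ≠ 0 ∧ ρ c = c ∧ c ≠ 0 ∧ Valued.v c ≤ 1 ∧ ∀ x, x ∈ Λ ↔ ∃ y, IsOrd ρ α c y ∧ x = z * y) ∧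
        (∀ x ∈ Λ, lam * x ∈ Λ) ∧ (∀ x ∈ Λ, lam' * x ∈ Λ) ∧ (∀ x ∈ Λ, lam'' * x ∈ Λ) ∧
        (∀ m, (∀ a ∈ Λ, Valued.v (h * Θ a * m + ρ (h * Θ a * m)) ≤ 1) ↔ m ∈ Λ)}.ncard =
      ∑ j ∈ Finset.range (J + 1),
        (if IsOrd ρ α (ϖE ^ j) lam ∧ IsOrd ρ α (ϖE ^ j) lam' ∧ IsOrd ρ α (ϖE ^ j) lam'' then (levelSet ρ Θ α ϖE h j 0).ncard else 0) := by
  classical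
  rw [setOf_orderLatt_selfDual_stable₃_eq_iUnion hρρ hvρ hα hα1 hint hΘΘ hΘρ hvΘ hρϖ hϖ0 hϖ1 hEval hh lam lam' lam'']
  set S : ℕ → Set (AddSubgroup K) := fun j =>
    {Λ | Λ ∈ levelSet ρ Θ α ϖE h j 0 ∧ (IsOrd ρ α (ϖE ^ j) lam ∧ IsOrd ρ α (ϖE ^ j) lam' ∧ IsOrd ρ α (ϖE ^ j) lam'')} with hS
  have hSfin : ∀ j, (S j).Finite := fun j => (hfin j).subset fun Λ hΛ => hΛ.1
  have hSdisj : ∀ i j, i ≠ j → Disjoint (S i) (S j) := by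
    intro i j hij
    rw [Set.disjoint_left]
    intro Λ hi hj
    exact hij (eq_of_mem_levelSet_of_mem_levelSet hvρ hα hα1 hint hρϖ hϖ0 hϖ1 h hi.1 hj.1)
  have hSempty : ∀ j, J < j → S j = ∅ := by
    intro j hj
    ext Λ
    simp only [hS, Set.mem_setOf_eq, Set.mem_empty_iff_false, iff_false, not_and]
    exact fun _ h' _ _ => not_isOrd_pow_of_lt hϖ1.le hJ hj h'
  have hScard : ∀ j, (S j).ncard =
      if IsOrd ρ α (ϖE ^ j) lam ∧ IsOrd ρ α (ϖE ^ j) lam' ∧ IsOrd ρ α (ϖE ^ j) lam'' then (levelSet ρ Θ α ϖE h j 0).ncard else 0 := by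
    intro j
    split_ifs with hlam
    · congr 1; ext Λ; simp only [hS, Set.mem_setOf_eq, and_iff_left_iff_imp]; exact fun _ => hlam
    · rw [Set.ncard_eq_zero (hSfin j)]; ext Λ
      simp only [hS, Set.mem_setOf_eq, Set.mem_empty_iff_false, iff_false, not_and]; exact fun _ h1 h2 h3 => hlam ⟨h1, h2, h3⟩
  have hUnion : (⋃ j : ℕ, S j) = ⋃ j ∈ Finset.range (J + 1), S j := by
    ext Λ
    simp only [Set.mem_iUnion, Finset.mem_range, exists_prop]
    constructor
    · rintro ⟨j, hj⟩
      refine ⟨j, ?_, hj⟩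
      by_contra hJj
      have : S j = ∅ := hSempty j (by omega)
      rw [this] at hj; exact hj
    · rintro ⟨j, -, hj⟩; exact ⟨j, hj⟩
  rw [show (⋃ j : ℕ, {Λ | Λ ∈ levelSet ρ Θ α ϖE h j 0 ∧ (IsOrd ρ α (ϖE ^ j) lam ∧ IsOrd ρ α (ϖE ^ j) lam' ∧ IsOrd ρ α (ϖE ^ j) lam'')}) =
    ⋃ j : ℕ, S j from rfl, hUnion]
  have hgen : ∀ n : ℕ, (⋃ j ∈ Finset.range n, S j).ncard = ∑ j ∈ Finset.range n, (S j).ncard := by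
    intro n
    induction n with
    | zero => simp
    | succ n ih =>
      rw [Finset.range_add_one, Finset.sum_insert Finset.notMem_range_self, Finset.set_biUnion_insert]
      have hdisj : Disjoint (S n) (⋃ x ∈ Finset.range n, S x) := by
        rw [Set.disjoint_left]
        intro Λ hn hU
        simp only [Set.mem_iUnion, Finset.mem_range, exists_prop] at hU
        obtain ⟨j, hj, hΛj⟩ := hU
        exact (Set.disjoint_left.1 (hSdisj n j (by omega))) hn hΛj
      rw [Set.ncard_union_eq hdisj (hSfin n) ?_, ih]
      exact (Finset.range n).finite_toSet.biUnion fun j _ => hSfin j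
  rw [hgen]
  exact Finset.sum_congr rfl fun j _ => hScard j

end WSide

/-! ## §2 (C₂^{X,Y}) The count transport and the axis with two tokens, in M-letters -/

section Line

variable {E M : Type*} [Field E] [Valued E ℤᵐ⁰] [Field M] [Valued M ℤᵐ⁰] {ρ Θ : M →+* M} {α : M}

/-- **(C₂^{X,Y}) THE COUNT TRANSPORT WITH TWO TOKENS**: the `γ₂`-fixed self-dual plane lattices with `c⁻¹X_W·B ⊆ B` and `c′⁻¹Y_W·B ⊆ B` are equinumerous with the
`lam`-, `(jE c)⁻¹ξ`-, `(jE c′)⁻¹η`-stable hermitian-self-dual order lattices (★ (C)'s bijection `B ↦ φ(B)`; ★ `forall_inv_smul_mulVec_mem_iff_of_line` twice).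
[cite: Kottwitz1986BaseChangeUnits, §1 pp. 240–241] [cite: Flicker1998UnitaryFL, p. 84 REMARK] [cite: Jacobowitz1962, §4] -/
theorem ncard_selfDual_fixed_twoToken_eq_ncard_orderLatt₃ (σ : E →+* E) (hvσ : ∀ a, Valued.v (σ a) = Valued.v a) {ϖ : E} (hϖ0 : ϖ ≠ 0) (hϖ1 : Valued.v ϖ ≤ 1)
    {H₂ : Matrix (Fin 2) (Fin 2) E} (hH₂ : IsUnit H₂.det) (jE : E →+* M)
    (hρρ : ∀ x, ρ (ρ x) = x) (hvρ : ∀ x, Valued.v (ρ x) = Valued.v x) (hα : ρ α ≠ α) (hα1 : Valued.v α ≤ 1)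
    (hint : ∀ z : M, Valued.v z ≤ 1 → Valued.v ((z - ρ z) / (α - ρ α)) ≤ 1)
    (hjv : ∀ c, Valued.v (jE c) ≤ 1 ↔ Valued.v c ≤ 1) (hjfix : ∀ z, ρ z = z ↔ ∃ c, jE c = z)
    (φ : (Fin 2 → E) →+ M) (hφs : ∀ (c : E) (x : Fin 2 → E), φ (c • x) = jE c * φ x) (hφi : Function.Injective φ) (hφo : Function.Surjective φ)
    {γ₂ : GL (Fin 2) E} {lam h : M} (hφγ : ∀ x, φ ((γ₂ : Matrix (Fin 2) (Fin 2) E).mulVec x) = lam * φ x) (hlam : Valued.v lam = 1)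
    (hform : ∀ x y, jE (pairing σ H₂ x y) = h * Θ (φ x) * φ y + ρ (h * Θ (φ x) * φ y))
    {XW : Matrix (Fin 2) (Fin 2) E} {ξ : M} (hξ : ∀ y, φ (XW *ᵥ y) = ξ * φ y)
    {YW : Matrix (Fin 2) (Fin 2) E} {η : M} (hη : ∀ y, φ (YW *ᵥ y) = η * φ y) (c c' : E) :
    {B : Submodule 𝒪[E] (Fin 2 → E) | IsSelfDualLattice σ ϖ H₂ B ∧ mapGL γ₂ B = B ∧ (∀ y ∈ B, c⁻¹ • (XW *ᵥ y) ∈ B) ∧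
        ∀ y ∈ B, c'⁻¹ • (YW *ᵥ y) ∈ B}.ncard =
      {Λ : AddSubgroup M | (∃ z c'' : M, z ≠ 0 ∧ ρ c'' = c'' ∧ c'' ≠ 0 ∧ Valued.v c'' ≤ 1 ∧
          ∀ x, x ∈ Λ ↔ ∃ y, (Valued.v y ≤ 1 ∧ Valued.v (y - ρ y) ≤ Valued.v (c'' * (α - ρ α))) ∧ x = z * y) ∧
        (∀ x ∈ Λ, lam * x ∈ Λ) ∧ (∀ x ∈ Λ, (jE c)⁻¹ * ξ * x ∈ Λ) ∧ (∀ x ∈ Λ, (jE c')⁻¹ * η * x ∈ Λ) ∧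
        (∀ m, (∀ a ∈ Λ, Valued.v (h * Θ a * m + ρ (h * Θ a * m)) ≤ 1) ↔ m ∈ Λ)}.ncard := by
  classical
  refine Set.ncard_congr (fun B _ => B.toAddSubgroup.map φ) ?_ ?_ ?_
  · rintro B ⟨hSD, hfix, hlev, hlev2⟩
    have hdual : dualLatt σ H₂ B = B := dualLatt_eq_self_of_isSelfDualLattice hvσ hH₂ hSD
    have hlev' := (forall_inv_smul_mulVec_mem_iff_of_line jE φ hφs hφi hξ c B).1 hlev
    have hlev2' := (forall_inv_smul_mulVec_mem_iff_of_line jE φ hφs hφi hη c' B).1 hlev2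
    obtain ⟨g, hBg, -, -, -⟩ := hSD
    subst hBg
    refine ⟨?_, ?_, hlev', hlev2', ?_⟩
    · exact exists_eq_mul_order_map_latt jE hρρ hα hα1 hint hjv hjfix φ hφs hφi g
    · exact (mapGL_eq_iff_forall_mul_mem jE hρρ hvρ hα hα1 hint hjv hjfix φ hφs hφi hφγ hlam g).1 hfix
    · exact forall_herm_iff_mem_of_dualLatt_eq σ H₂ jE ρ Θ h hjv φ hφi hφo hform hdual
  · intro B B' _ _ hBB'
    exact map_toAddSubgroup_injective φ hφi hBB'
  · rintro Λ ⟨⟨z, c'', hz0, hcfix, hc0, hc1, hΛ⟩, hstab, hstab', hstab'', hself⟩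
    obtain ⟨g, hg⟩ := exists_latt_map_eq_of_order jE hρρ hα hα1 hint hjv hjfix φ hφs hφo hz0 hcfix hc0 hc1 hΛ
    refine ⟨latt (g : Matrix (Fin 2) (Fin 2) E), ⟨?_, ?_, ?_, ?_⟩, hg⟩
    · refine isSelfDualLattice_latt_of_dualLatt_eq σ hvσ hϖ0 hϖ1 hH₂ g ?_
      refine dualLatt_eq_of_forall_herm_iff_mem σ H₂ jE ρ Θ h hjv φ hφi hform ?_
      rw [hg]; exact hself
    · refine (mapGL_eq_iff_forall_mul_mem jE hρρ hvρ hα hα1 hint hjv hjfix φ hφs hφi hφγ hlam g).2 ?_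
      rw [hg]; exact hstab
    · refine (forall_inv_smul_mulVec_mem_iff_of_line jE φ hφs hφi hξ c _).2 ?_
      rw [hg]; exact hstab'
    · refine (forall_inv_smul_mulVec_mem_iff_of_line jE φ hφs hφi hη c' _).2 ?_
      rw [hg]; exact hstab''

/-- **AXIS TERM WITH TWO TOKENS, IN M-LETTERS**: `#{B ∣ SD_W, γ₂B = B, c⁻¹X_W·B ⊆ B, c′⁻¹Y_W·B ⊆ B} = Σ_{j<J+1} [IsOrd_j lam ∧ IsOrd_j ((jE c)⁻¹ξ) ∧ IsOrd_j ((jE c′)⁻¹η)]·#levelSet(j, 0)`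
— (C₂^{X,Y}) ∘ (W4₃). [cite: Kottwitz1986BaseChangeUnits, §1 pp. 240–241] [cite: Flicker1998UnitaryFL, p. 84 REMARK] [cite: Jacobowitz1962, §4] -/
theorem ncard_selfDual_fixed_twoToken_plane_eq_sum_levelSet_zero (σ : E →+* E) (hvσ : ∀ a, Valued.v (σ a) = Valued.v a) {ϖ : E}
    (hϖ : Valued.v ϖ = WithZero.exp (-1 : ℤ)) {H₂ : Matrix (Fin 2) (Fin 2) E} (hH₂ : IsUnit H₂.det) (jE : E →+* M)
    (hρρ : ∀ x, ρ (ρ x) = x) (hvρ : ∀ x, Valued.v (ρ x) = Valued.v x) (hα : ρ α ≠ α) (hα1 : Valued.v α ≤ 1)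
    (hint : ∀ z : M, Valued.v z ≤ 1 → Valued.v ((z - ρ z) / (α - ρ α)) ≤ 1)
    (hΘΘ : ∀ x, Θ (Θ x) = x) (hΘρ : ∀ x, Θ (ρ x) = ρ (Θ x)) (hvΘ : ∀ x, Valued.v (Θ x) = Valued.v x)
    (hjv : ∀ c, Valued.v (jE c) ≤ 1 ↔ Valued.v c ≤ 1) (hjfix : ∀ z, ρ z = z ↔ ∃ c, jE c = z)
    (hjpow : ∀ (t : E) (n : ℤ), Valued.v (jE t) = Valued.v (jE ϖ) ^ n ↔ Valued.v t = Valued.v ϖ ^ n)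
    (hEval : ∀ c : M, ρ c = c → c ≠ 0 → Valued.v c ≤ 1 → ∃ n : ℕ, Valued.v c = Valued.v (jE ϖ) ^ n)
    (φ : (Fin 2 → E) →+ M) (hφs : ∀ (c : E) (x : Fin 2 → E), φ (c • x) = jE c * φ x) (hφi : Function.Injective φ) (hφo : Function.Surjective φ)
    {γ₂ : GL (Fin 2) E} {lam h : M} (hφγ : ∀ x, φ ((γ₂ : Matrix (Fin 2) (Fin 2) E).mulVec x) = lam * φ x) (hlam : Valued.v lam = 1)
    (hh : h ≠ 0) (hform : ∀ x y, jE (pairing σ H₂ x y) = h * Θ (φ x) * φ y + ρ (h * Θ (φ x) * φ y))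
    {J : ℕ} (hJ : ¬ IsOrd ρ α (jE ϖ ^ (J + 1)) lam) (hfin0 : ∀ j, (levelSet ρ Θ α (jE ϖ) h j 0).Finite)
    {XW : Matrix (Fin 2) (Fin 2) E} {ξ : M} (hξ : ∀ y, φ (XW *ᵥ y) = ξ * φ y)
    {YW : Matrix (Fin 2) (Fin 2) E} {η : M} (hη : ∀ y, φ (YW *ᵥ y) = η * φ y) (c c' : E) :
    {B : Submodule 𝒪[E] (Fin 2 → E) | IsSelfDualLattice σ ϖ H₂ B ∧ mapGL γ₂ B = B ∧ (∀ y ∈ B, c⁻¹ • (XW *ᵥ y) ∈ B) ∧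
        ∀ y ∈ B, c'⁻¹ • (YW *ᵥ y) ∈ B}.ncard =
      ∑ j ∈ Finset.range (J + 1), (if IsOrd ρ α (jE ϖ ^ j) lam ∧ IsOrd ρ α (jE ϖ ^ j) ((jE c)⁻¹ * ξ) ∧ IsOrd ρ α (jE ϖ ^ j) ((jE c')⁻¹ * η) then
        (levelSet ρ Θ α (jE ϖ) h j 0).ncard else 0) := by
  have hvϖ0 : Valued.v ϖ ≠ 0 := by rw [hϖ]; exact WithZero.exp_ne_zero
  have hϖ0 : ϖ ≠ 0 := fun h0 => by rw [h0, map_zero] at hvϖ0; exact hvϖ0 rfl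
  have hϖ1 : Valued.v ϖ < 1 := by rw [hϖ, ← WithZero.exp_zero, WithZero.exp_lt_exp]; norm_num
  have hρϖ : ρ (jE ϖ) = jE ϖ := (hjfix _).2 ⟨ϖ, rfl⟩
  have hϖE0 : jE ϖ ≠ 0 := (map_ne_zero jE).2 hϖ0
  have hϖE1 : Valued.v (jE ϖ) < 1 := by
    refine lt_of_le_of_ne ((hjv ϖ).2 hϖ1.le) fun hle => ?_
    have := (hjpow ϖ 0).1 (by rw [zpow_zero]; exact hle)
    rw [zpow_zero] at this
    exact hϖ1.ne this
  rw [ncard_selfDual_fixed_twoToken_eq_ncard_orderLatt₃ σ hvσ hϖ0 hϖ1.le hH₂ jE hρρ hvρ hα hα1 hint hjv hjfix φ hφs hφi hφo hφγ hlam hform hξ hη c c']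
  exact ncard_orderLatt_selfDual_stable₃_eq_sum hρρ hvρ hα hα1 hint hΘΘ hΘρ hvΘ hρϖ hϖE0 hϖE1 hEval hh lam _ _ hJ hfin0

end Line

end Summit.HodgeConjecture.HodgeConjecture.Cruxes.H413.F0P3cDyRamBlockCensusOrderFormTwoTokensAxis

end
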